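import Literature.NumberTheory.DiophantineGeometry.AVGaloisModuleTateRankOfKerRankProofs
import Literature.AlgebraicGeometry.Motives.AbelianVarietyKerRankOfCube
import Literature.AlgebraicGeometry.Motives.CechComplexPseudoCoherentGeneralProofs
import HarnessLib

/-!
# `rank_{ℤ_ℓ} T_ℓ A = 2 dim A` reduced to the Theorem of the Cube

Serre–Tate, *Good reduction of abelian varieties*, §1 (p. 493): "`T_l(A) = lim← A_{lⁿ}` [...] is a
free module of rank `2 dim(A)` over the ring `ℤ_l`" (for `l ≠ char K`), the input being that `A_m`
is a free `ℤ/mℤ`-module of rank `2 dim(A)` for `m` prime to the characteristic (loc. cit., citing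
Lang, *Abelian Varieties*, Ch. VII; Mumford, *Abelian Varieties*, §6, Application 3; Görtz–Wedhorn,
*Algebraic Geometry II*, Prop. 27.188 (1) and Remark 27.193).

In the tree this is the named fact
`Literature.AlgebraicGeometry.Motives.AbelianVariety.finrank_tateModule_eq A ℓ`
(`NumberTheory/DiophantineGeometry/AVGaloisModule`), together with its companions
`finrank_rationalTateModule_eq A ℓ` (`dim_{ℚ_ℓ} V_ℓ A = 2 dim A`) and the structure statement
`T_ℓ A ≅ ℤ_ℓ^{2 dim A}`. The chain of *proved* reductions is

* `finrank_tateModule_eq_of_natCard_torsionPoints` (`AVGaloisModuleTateRankProofs`): from the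
  torsion count `#A[n](K̄) = n^{2 dim A}` (`natCard_torsionPoints_of_isAlgClosed A K̄`);
* `finrank_tateModule_eq_of_kerRank` (`AVGaloisModuleTateRankOfKerRankProofs`): from
  `deg [n]_A = n^{2g}` (`kerRank_zsmul_id A`, Görtz–Wedhorn II, Prop. 27.186), the étaleness of
  `[n]_A` (Prop. 27.187) being proved in `Motives/AbelianVarietyLie`;
* `kerRank_zsmul_id_of_theoremOfCube_linEquiv` (`Motives/AbelianVarietyKerRankOfCube`):
  `deg [n]_A = n^{2g}` from the Theorem of the Cube `theoremOfCube_linEquiv` (Görtz–Wedhorn II,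
  Thm. 24.73) **alone**, Prop. 23.83/23.84 and Lemma 25.150 being proved in the tree.

This file records the composite, so that the trust base of the three `AVGaloisModule` statements is
visible in one place — it is exactly the Theorem of the Cube (coherent cohomology and base change;
currently decomposed in `Motives/AbelianVarietyTheoremOfCubeProofs` into the leaves
`cechComplex_pseudoCoherent_general`, `theoremOfCube_trivialAlong_thickeningPt`,
`trivialLocus_descendsAlongStages`, cf. `theoremOfCube_linEquiv_of_pseudoCoherent_of_stepI_of_fibre`)
— and so that the discharge becomes the one-liner
`A.finrank_tateModule_eq_of_theoremOfCube_linEquiv ℓ theoremOfCube_linEquiv_holds` once Thm. 24.73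
lands. No new named fact is introduced here.

**The single remaining leaf (section `PseudoCoherent`).** Two of the three leaves are meanwhile
theorems of the tree — `trivialLocus_descendsAlongStages_holds` (`Motives/TheoremOfCubeLimitProofs`)
and `theoremOfCube_trivialAlong_thickeningPt_holds` (`Motives/CubeStepI`, Görtz–Wedhorn II,
Lemma 24.72, Step (I)) — so the three `AVGaloisModule` statements are proved functions of the ONE
named fact `cechComplex_pseudoCoherent_general` (`Motives/GrothendieckComplexSectionAlongCech`:
Görtz–Wedhorn II, Thm. 23.133 / Cor. 23.135, the pseudo-coherence of the Čech complex of `𝒪(D)`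
over an affine open of the base, i.e. the finiteness of the coherent cohomology of proper morphisms,
absent from Mathlib): `finrank_tateModule_eq_of_pseudoCoherent_general` and its two companions,
through `theoremOfCube_linEquiv_of_pseudoCoherent_general` (`Motives/AbelianVarietyTheoremOfCubeProofs`,
section `OneLeaf`).

**The discharges (section `Discharge`).** That leaf is meanwhile a theorem of the tree as well —
`cechComplex_pseudoCoherent_general_holds` (`Motives/CechComplexPseudoCoherentGeneralProofs`:
Görtz–Wedhorn II, Thm. 23.133 / Cor. 23.135 by Chow's lemma, dévissage and noetherian
approximation) — so the two named facts of `AVGaloisModule` HOLD unconditionally: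
`finrank_tateModule_eq_holds` (`rank_{ℤ_ℓ} T_ℓ A = 2 dim A` for `ℓ` invertible in `K`, Serre–Tate
1968, §1, p. 493) and `finrank_rationalTateModule_eq_holds` (`dim_{ℚ_ℓ} V_ℓ A = 2 dim A`, Mumford
§19, p. 172), together with the structure statement `T_ℓ A ≅ ℤ_ℓ^{2 dim A}`
(`nonempty_tateModule_linearEquiv`) and the printed form `finrank_tateModule_eq_two_mul_dim`. They are
the one-liners `A.finrank_tateModule_eq_of_pseudoCoherent_general ℓ cechComplex_pseudoCoherent_general_holds`
etc.; every step of the printed chain Thm. 23.133 → Thm. 24.66, Lemma 24.72 → Thm. 24.73 (cube) →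
Prop. 27.167 → Prop. 27.184–27.188 (`deg [n]_A = n^{2g}`, `#A[n](K̄) = n^{2g}`) → Remark 27.193
(`T_ℓ A` free of rank `2g`) is a theorem of this tree, with the standard axioms only.

## References

* [SerreTate1968] J.-P. Serre, J. Tate, *Good reduction of abelian varieties*, Ann. of Math. (2)
  88 (1968), 492–517, doi:10.2307/1970722: §1, p. 493 (read via the held copy, Serre, *Œuvres* II,
  PDF p. 448).
* [GortzWedhorn2023] U. Görtz, T. Wedhorn, *Algebraic Geometry II: Cohomology of Schemes*,
  Springer Spektrum (2023), doi:10.1007/978-3-658-43031-3: Thm. 23.133 (p. 478), Cor. 23.135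
  (p. 480), Lemma 24.72 (p. 548), Thm. 24.73 (p. 550), Prop. 27.186–27.188 (pp. 887–888), Remark and
  Definition 27.193 (pp. 891–892: "If `ℓ ≠ char(k)`, then `T_ℓ(X)` is a free `ℤ_ℓ`-module of rank
  `2g`"), read in the held copy.
* [MumfordAV1970] D. Mumford, *Abelian Varieties* (1970): §6, Application 3 (Proposition p. 64);
  §19 (pp. 171–172).
-/

noncomputable section

universe u

namespace Literature.NumberTheory.DiophantineGeometry

section AbelianVariety
open Literature.AlgebraicGeometry.Motives (AbelianVariety theoremOfCube_linEquiv)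
open Literature.AlgebraicGeometry.Motives.AbelianVariety

variable {K : Type u} [Field K] (A : AbelianVariety K) (ℓ : ℕ) [Fact ℓ.Prime]

/-- **`rank_{ℤ_ℓ} T_ℓ A = 2 dim A` (for `ℓ` invertible in `K`) from the Theorem of the Cube
alone.** The named fact `finrank_tateModule_eq A ℓ` (Serre–Tate 1968, §1, p. 493: "`T_l(A)` is a
free module of rank `2 dim(A)` over the ring `ℤ_l`") follows from the single named fact
`theoremOfCube_linEquiv` (Görtz–Wedhorn II, Thm. 24.73): the cube gives `deg [n]_A = n^{2g}`
(`kerRank_zsmul_id_of_theoremOfCube_linEquiv`, Prop. 27.186), whence `#A[n](K̄) = n^{2g}` for `n`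
invertible in `K` (Prop. 27.188 (1)) and `T_ℓ A = lim← A[ℓ^m](K̄)` free of rank `2g`
(Remark 27.193; `finrank_tateModule_eq_of_kerRank`).
[cite: SerreTate1968, §1 (p. 493)]
[cite: GortzWedhorn2023, Remark and Definition 27.193 (pp. 891–892) with Thm. 24.73 (p. 550)] -/
theorem _root_.Literature.AlgebraicGeometry.Motives.AbelianVariety.finrank_tateModule_eq_of_theoremOfCube_linEquiv
    (hcube : theoremOfCube_linEquiv.{u}) : A.finrank_tateModule_eq ℓ :=
  A.finrank_tateModule_eq_of_kerRank ℓ (kerRank_zsmul_id_of_theoremOfCube_linEquiv A hcube)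

/-- **`dim_{ℚ_ℓ} V_ℓ A = 2 dim A` (for `ℓ` invertible in `K`) from the Theorem of the Cube
alone**: the named fact `finrank_rationalTateModule_eq A ℓ` (Mumford §19, p. 172; Serre–Tate
1968, §1, `V_l(A) = T_l(A) ⊗ ℚ_l`) from `theoremOfCube_linEquiv` (Görtz–Wedhorn II, Thm. 24.73),
through `kerRank_zsmul_id_of_theoremOfCube_linEquiv` and `finrank_rationalTateModule_eq_of_kerRank`.
[cite: SerreTate1968, §1 (p. 493)]
[cite: GortzWedhorn2023, Remark and Definition 27.193 (pp. 891–892) with Thm. 24.73 (p. 550)] -/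
theorem _root_.Literature.AlgebraicGeometry.Motives.AbelianVariety.finrank_rationalTateModule_eq_of_theoremOfCube_linEquiv
    (hcube : theoremOfCube_linEquiv.{u}) : A.finrank_rationalTateModule_eq ℓ :=
  A.finrank_rationalTateModule_eq_of_kerRank ℓ (kerRank_zsmul_id_of_theoremOfCube_linEquiv A hcube)

/-- **`T_ℓ A ≅ ℤ_ℓ^{2 dim A}` (for `ℓ` invertible in `K`) from the Theorem of the Cube alone**
(Serre–Tate 1968, §1; Görtz–Wedhorn II, Remark 27.193 with Thm. 24.73):
`nonempty_tateModule_linearEquiv_of_kerRank` composed with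
`kerRank_zsmul_id_of_theoremOfCube_linEquiv`.
[cite: SerreTate1968, §1 (p. 493)]
[cite: GortzWedhorn2023, Remark and Definition 27.193 (pp. 891–892) with Thm. 24.73 (p. 550)] -/
theorem _root_.Literature.AlgebraicGeometry.Motives.AbelianVariety.nonempty_tateModule_linearEquiv_of_theoremOfCube_linEquiv
    (hcube : theoremOfCube_linEquiv.{u}) (hℓ : (ℓ : K) ≠ 0) :
    Nonempty (A.tateModule ℓ ≃ₗ[ℤ_[ℓ]] (Fin (2 * A.dim) → ℤ_[ℓ])) :=
  A.nonempty_tateModule_linearEquiv_of_kerRank ℓ (kerRank_zsmul_id_of_theoremOfCube_linEquiv A hcube)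
    hℓ

/-- Usage: for an abelian variety `A/K` and a prime `ℓ` invertible in `K`, granted the Theorem of
the Cube, `rank_{ℤ_ℓ} T_ℓ A = 2 dim A`. -/
example (hcube : theoremOfCube_linEquiv.{u}) (hℓ : (ℓ : K) ≠ 0) :
    Module.finrank ℤ_[ℓ] (A.tateModule ℓ) = 2 * A.dim :=
  A.finrank_tateModule_eq_of_theoremOfCube_linEquiv ℓ hcube hℓ

end AbelianVariety

/-! ### From the pseudo-coherence of the Čech complex of `𝒪(D)` alone (Görtz–Wedhorn II, Thm. 23.133 / Cor. 23.135) -/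

section PseudoCoherent
open Literature.AlgebraicGeometry.Motives (AbelianVariety theoremOfCube_linEquiv
  cechComplex_pseudoCoherent_general theoremOfCube_linEquiv_of_pseudoCoherent_general)
open Literature.AlgebraicGeometry.Motives.AbelianVariety

variable {K : Type u} [Field K] (A : AbelianVariety K) (ℓ : ℕ) [Fact ℓ.Prime]

/-- **`rank_{ℤ_ℓ} T_ℓ A = 2 dim A` (for `ℓ` invertible in `K`) from the finiteness of coherent
cohomology alone.** The named fact `finrank_tateModule_eq A ℓ` (Serre–Tate 1968, §1, p. 493:
"`T_l(A)` [...] is a free module of rank `2 dim(A)` over the ring `ℤ_l`"; Görtz–Wedhorn II, Remark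
27.193: "If `ℓ ≠ char(k)`, then `T_ℓ(X)` is a free `ℤ_ℓ`-module of rank `2g`") follows from the
single named fact `cechComplex_pseudoCoherent_general` (Görtz–Wedhorn II, Thm. 23.133 / Cor. 23.135
for `𝒪(D)` in Čech form): with Step (I) of Lemma 24.72 (`theoremOfCube_trivialAlong_thickeningPt_holds`)
and the noetherian descent of the fibre condition (`trivialLocus_descendsAlongStages_holds`), both
proved, it gives the Theorem of the Cube (`theoremOfCube_linEquiv_of_pseudoCoherent_general`,
Thm. 24.73), whence the claim (`finrank_tateModule_eq_of_theoremOfCube_linEquiv`). Every other step of the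
printed chain Thm. 23.133 → Thm. 24.66, Lemma 24.72 → Thm. 24.73 → Prop. 27.167 → Prop. 27.184–27.188 →
Remark 27.193 is proved in this tree.
[cite: SerreTate1968, §1 (p. 493)]
[cite: GortzWedhorn2023, Remark and Definition 27.193 (pp. 891–892) with Thm. 24.73 (p. 550) and Thm. 23.133 / Cor. 23.135 (pp. 478–480)] -/
theorem _root_.Literature.AlgebraicGeometry.Motives.AbelianVariety.finrank_tateModule_eq_of_pseudoCoherent_general
    (h : cechComplex_pseudoCoherent_general.{u}) : A.finrank_tateModule_eq ℓ :=
  A.finrank_tateModule_eq_of_theoremOfCube_linEquiv ℓ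
    (theoremOfCube_linEquiv_of_pseudoCoherent_general h)

/-- **`dim_{ℚ_ℓ} V_ℓ A = 2 dim A` (for `ℓ` invertible in `K`) from the finiteness of coherent
cohomology alone**: the named fact `finrank_rationalTateModule_eq A ℓ` (Mumford §19, p. 172;
Serre–Tate 1968, §1, `V_l(A) = T_l(A) ⊗ ℚ_l`) from `cechComplex_pseudoCoherent_general`
(Görtz–Wedhorn II, Thm. 23.133 / Cor. 23.135), through
`theoremOfCube_linEquiv_of_pseudoCoherent_general` and
`finrank_rationalTateModule_eq_of_theoremOfCube_linEquiv`.
[cite: SerreTate1968, §1 (p. 493)]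
[cite: GortzWedhorn2023, Remark and Definition 27.193 (pp. 891–892) with Thm. 24.73 (p. 550) and Thm. 23.133 / Cor. 23.135 (pp. 478–480)] -/
theorem _root_.Literature.AlgebraicGeometry.Motives.AbelianVariety.finrank_rationalTateModule_eq_of_pseudoCoherent_general
    (h : cechComplex_pseudoCoherent_general.{u}) : A.finrank_rationalTateModule_eq ℓ :=
  A.finrank_rationalTateModule_eq_of_theoremOfCube_linEquiv ℓ
    (theoremOfCube_linEquiv_of_pseudoCoherent_general h)

/-- **`T_ℓ A ≅ ℤ_ℓ^{2 dim A}` (for `ℓ` invertible in `K`) from the finiteness of coherent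
cohomology alone** (Serre–Tate 1968, §1; Görtz–Wedhorn II, Remark 27.193 with Thm. 24.73 and
Thm. 23.133): `nonempty_tateModule_linearEquiv_of_theoremOfCube_linEquiv` composed with
`theoremOfCube_linEquiv_of_pseudoCoherent_general`.
[cite: SerreTate1968, §1 (p. 493)]
[cite: GortzWedhorn2023, Remark and Definition 27.193 (pp. 891–892) with Thm. 24.73 (p. 550) and Thm. 23.133 / Cor. 23.135 (pp. 478–480)] -/
theorem _root_.Literature.AlgebraicGeometry.Motives.AbelianVariety.nonempty_tateModule_linearEquiv_of_pseudoCoherent_general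
    (h : cechComplex_pseudoCoherent_general.{u}) (hℓ : (ℓ : K) ≠ 0) :
    Nonempty (A.tateModule ℓ ≃ₗ[ℤ_[ℓ]] (Fin (2 * A.dim) → ℤ_[ℓ])) :=
  A.nonempty_tateModule_linearEquiv_of_theoremOfCube_linEquiv ℓ
    (theoremOfCube_linEquiv_of_pseudoCoherent_general h) hℓ

/-- Usage: for an abelian variety `A/K` and a prime `ℓ` invertible in `K`, granted the
pseudo-coherence of the Čech complex of `𝒪(D)` (Görtz–Wedhorn II, Thm. 23.133 / Cor. 23.135),
`rank_{ℤ_ℓ} T_ℓ A = 2 dim A`. -/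
example (h : cechComplex_pseudoCoherent_general.{u}) (hℓ : (ℓ : K) ≠ 0) :
    Module.finrank ℤ_[ℓ] (A.tateModule ℓ) = 2 * A.dim :=
  A.finrank_tateModule_eq_of_pseudoCoherent_general ℓ h hℓ

end PseudoCoherent

/-! ### The discharges: `rank_{ℤ_ℓ} T_ℓ A = 2 dim A` and `dim_{ℚ_ℓ} V_ℓ A = 2 dim A` hold -/

section Discharge
open Literature.AlgebraicGeometry.Motives (AbelianVariety cechComplex_pseudoCoherent_general_holds)
open Literature.AlgebraicGeometry.Motives.AbelianVariety

variable {K : Type u} [Field K] (A : AbelianVariety K) (ℓ : ℕ) [Fact ℓ.Prime]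

/-- **Serre–Tate 1968, §1 (p. 493): for an abelian variety `A` over a field `K` and a prime `ℓ`
different from the characteristic, `T_ℓ(A) = lim← A[ℓⁿ](K̄)` "is a free module of rank `2 dim(A)`
over the ring `ℤ_ℓ`"** — the named fact `finrank_tateModule_eq A ℓ` of `AVGaloisModule`
(`∀ hℓ : (ℓ : K) ≠ 0, finrank_{ℤ_ℓ} (T_ℓ A) = 2 * A.dim`) **holds**. Proof, following the printed
one (loc. cit., citing Lang, *Abelian Varieties*, Ch. VII for "`A_m` is a free `ℤ/mℤ`-module of rank
`2 dim(A)`"; Görtz–Wedhorn II, Remark 27.193 with Prop. 27.188 (1), Prop. 27.186, Thm. 24.73 and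
Thm. 23.133): `finrank_tateModule_eq_of_pseudoCoherent_general` (this file: the count
`#A[ℓⁿ](K̄) = ℓ^{2gn}` from `deg [n]_A = n^{2g}`, from the Theorem of the Cube, from the
pseudo-coherence of the Čech complex of `𝒪(D)`; then `T_ℓ A ≅ ℤ_ℓ^{2g}` by the generic structure
theorem `TateModule.finrank_eq_of_card_torsionBy`) applied to the theorem
`cechComplex_pseudoCoherent_general_holds` (`Motives/CechComplexPseudoCoherentGeneralProofs`).
[cite: SerreTate1968, §1 (p. 493)]
[cite: GortzWedhorn2023, Remark and Definition 27.193 (pp. 891–892), with Prop. 27.188 (1) (p. 888), Thm. 24.73 (p. 550), Thm. 23.133 / Cor. 23.135 (pp. 478–480)] -/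
theorem _root_.Literature.AlgebraicGeometry.Motives.AbelianVariety.finrank_tateModule_eq_holds :
    A.finrank_tateModule_eq ℓ :=
  A.finrank_tateModule_eq_of_pseudoCoherent_general ℓ cechComplex_pseudoCoherent_general_holds

/-- **Mumford, *Abelian Varieties*, §19 (p. 172) / Serre–Tate 1968, §1 (`V_ℓ(A) = T_ℓ(A) ⊗ ℚ_ℓ`):
for a prime `ℓ` invertible in `K`, `dim_{ℚ_ℓ} V_ℓ A = 2 dim A`** — the named fact
`finrank_rationalTateModule_eq A ℓ` of `AVGaloisModule` **holds**:
`finrank_rationalTateModule_eq_of_pseudoCoherent_general` applied to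
`cechComplex_pseudoCoherent_general_holds` (equivalently, `finrank_tateModule_eq_holds` and
`Module.finrank_baseChange`, `T_ℓ A` being free).
[cite: MumfordAV1970, §19 p. 172] [cite: SerreTate1968, §1 (p. 493)] -/
theorem _root_.Literature.AlgebraicGeometry.Motives.AbelianVariety.finrank_rationalTateModule_eq_holds :
    A.finrank_rationalTateModule_eq ℓ :=
  A.finrank_rationalTateModule_eq_of_pseudoCoherent_general ℓ cechComplex_pseudoCoherent_general_holds

/-- **`T_ℓ A ≅ ℤ_ℓ^{2 dim A}` as `ℤ_ℓ`-modules, for a prime `ℓ` invertible in `K`** (Serre–Tate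
1968, §1, p. 493: "free module of rank `2 dim(A)` over the ring `ℤ_ℓ`"; Görtz–Wedhorn II, Remark
27.193: "If `ℓ ≠ char(k)`, then `T_ℓ(X)` is a free `ℤ_ℓ`-module of rank `2g`"), unconditionally:
`nonempty_tateModule_linearEquiv_of_pseudoCoherent_general` applied to
`cechComplex_pseudoCoherent_general_holds`.
[cite: SerreTate1968, §1 (p. 493)]
[cite: GortzWedhorn2023, Remark and Definition 27.193 (pp. 891–892)] -/
theorem _root_.Literature.AlgebraicGeometry.Motives.AbelianVariety.nonempty_tateModule_linearEquiv
    (hℓ : (ℓ : K) ≠ 0) : Nonempty (A.tateModule ℓ ≃ₗ[ℤ_[ℓ]] (Fin (2 * A.dim) → ℤ_[ℓ])) :=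
  A.nonempty_tateModule_linearEquiv_of_pseudoCoherent_general ℓ
    cechComplex_pseudoCoherent_general_holds hℓ

/-- **`rank_{ℤ_ℓ} T_ℓ A = 2 dim A` for a prime `ℓ` invertible in `K`**, the statement of
`finrank_tateModule_eq A ℓ` unfolded (Serre–Tate 1968, §1, p. 493). [cite: SerreTate1968, §1 (p. 493)] -/
theorem _root_.Literature.AlgebraicGeometry.Motives.AbelianVariety.finrank_tateModule_eq_two_mul_dim
    (hℓ : (ℓ : K) ≠ 0) : Module.finrank ℤ_[ℓ] (A.tateModule ℓ) = 2 * A.dim :=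
  A.finrank_tateModule_eq_holds ℓ hℓ

/-- **`dim_{ℚ_ℓ} V_ℓ A = 2 dim A` for a prime `ℓ` invertible in `K`**, the statement of
`finrank_rationalTateModule_eq A ℓ` unfolded (Mumford §19, p. 172). [cite: MumfordAV1970, §19 p. 172] -/
theorem _root_.Literature.AlgebraicGeometry.Motives.AbelianVariety.finrank_rationalTateModule_eq_two_mul_dim
    (hℓ : (ℓ : K) ≠ 0) : Module.finrank ℚ_[ℓ] (A.rationalTateModule ℓ) = 2 * A.dim :=
  A.finrank_rationalTateModule_eq_holds ℓ hℓ

/-- Usage: for an abelian surface `A/K` (`A.dim = 2`) and a prime `ℓ` invertible in `K`,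
`T_ℓ A` has `ℤ_ℓ`-rank `4`, unconditionally. -/
example (hA : A.dim = 2) (hℓ : (ℓ : K) ≠ 0) : Module.finrank ℤ_[ℓ] (A.tateModule ℓ) = 4 :=
  (A.finrank_tateModule_eq_two_mul_dim ℓ hℓ).trans (by omega)

end Discharge

end Literature.NumberTheory.DiophantineGeometry

end
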